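import Summits.ValiantsHypothesis.ValiantsHypothesis.Theorems.GrenetZeonDualUnipotentThreeHalvesHeavyTopCompositionBlocks
import Summits.ValiantsHypothesis.ValiantsHypothesis.Theorems.GrenetZeonDualUnipotentThreeHalvesHeavyTopCompositionCore

/-!
# `GrenetZeon.DualUnipotentThreeHalves` (stmt-ValiantsHypothesis-24318), R2 `HeavyTopLaw` — instrument kernel row
# «§8 enumerator soundness», LAYER 3b: `HeavyTopInst 4 6` FROM DIMENSION BOUNDS ON IRREDUCIBLE NILPOTENT SPACES
# (`ι(4) ≤ 3 ∧ ι(5) ≤ 7 ∧ ι(6) ≤ 11 ⟹ HeavyTopInst 4 6`, INSTANCES.md v2.2a §7–§8 in the kernel)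

`ι(s) ≤ β` is taken as a HYPOTHESIS in the natural form: every linear subspace `V ⊆ M_s(ℂ)` of nilpotent matrices
acting IRREDUCIBLY on `ℂ^s` (no invariant subspace other than `0`, `ℂ^s`) has `dim V ≤ β`.  Given `hι4 : ι(4) ≤ 3`,
`hι5 : ι(5) ≤ 7`, `hι6 : ι(6) ≤ 11`, every affine nilpotent `6 × 6` pencil `N` over `ℂ^{4×4}` is flag-cheap:

take the composition chain of `W = ℂ·N(0) + N_lin(ℂ^{4×4})` in matrix clothes (✓ layer 2 `exists_block_conj`: `P`, levels
`lvl`, irreducible diagonal blocks; the pencil is block upper triangular as a polynomial matrix, ✓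
`pencil_blockUpper_of_forall_mem`) and the cut profile `a t = #{i : lvl i < t}` (`a 0 = 0 < a 1 < ⋯ < a L = 6`).
* If some cut has `2 ≤ a t ≤ 4`, COARSEN to the two levels `{lvl < t}`, `{lvl ≥ t}`: Gerstenhaber on the two block spaces
  (✓ port-3 g2's `flagCheap_of_invariant_levels`) costs `2·4 + C(a,2) + C(6−a,2) ≤ 15 < 16`.
* Otherwise every cut lies in `{0,1,5,6}`, so `L ≤ 3` and the level sizes are `(6)`, `(1,5)`, `(5,1)` or `(1,4,1)`: the big
  block is an IRREDUCIBLE nilpotent space of `M_6`, `M_5` or `M_4` (✓ `finrank_blockSpan_le`), the unit blocks are `0`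
  (`C(1,2) = 0`), and ✓ `flagCheap_of_block_dims` costs `4 + 11`, `8 + 7`, `8 + 7`, `12 + 3`, all `= 15 < 16`.
No «size-2 simple factor» lemma is needed: a cut of size `2` is a coarsening cut.

* `heavyTopInst_four_six_of_iota (hι4) (hι5) (hι6) : HeavyTopInst 4 6`.

HONEST LABEL: a CONDITIONAL instance row — the three `ι`-bounds are OPEN finite questions (`ι(4) ≥ 3` is in the kernel,
✓ `irrFour_*`; numerics suggest `ι(4) = 3`); nothing here proves `HeavyTopInst 4 6` outright, nor `HeavyTopLaw`, 24318,
S3b; `VP ≠ VNP` is NOT proved; no summit statement is proved here.  No definitions, no named facts.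
(Desk RULING #299 (a); instance table val-port-3 g2; critic of record val-idea-crit-3 g4.)  [folklore bookkeeping]
-/

noncomputable section

-- single-conjunct layout: Sub = Summit, duplicated namespace component intended
set_option linter.dupNamespace false

namespace Summit.ValiantsHypothesis.ValiantsHypothesis.Theorems.GrenetZeon.HeavyTopCompositionBound

open MvPolynomial Matrix
open scoped BigOperators
open Summit.ValiantsHypothesis.ValiantsHypothesis.Cruxes.TwoDimCoefficients.DimTwoCases (AffMat IsAffine)
open Summit.ValiantsHypothesis.ValiantsHypothesis.Theorems.GrenetZeon.RadicalSplit
open Summit.ValiantsHypothesis.ValiantsHypothesis.Theorems.GrenetZeon.HeavyTopInvariantFlag (flagCheap_of_invariant_levels)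
open Literature.LinearAlgebra.Matrix.GerstenhaberNilpotentSubspace (finrank_le_choose_two)

/-! ## §1 Cut profiles of a level function on `Fin 6` -/

/-- The cut profile `a t = #{i : lvl i < t}` steps by the level sizes. [folklore] -/
theorem cut_succ {m : ℕ} (lvl : Fin m → ℕ) (t : ℕ) :
    (Finset.univ.filter (fun i => lvl i < t + 1)).card =
      (Finset.univ.filter (fun i => lvl i < t)).card + (Finset.univ.filter (fun i => lvl i = t)).card := by
  classical
  rw [← Finset.card_union_of_disjoint]
  · congr 1; ext i; simp only [Finset.mem_filter, Finset.mem_univ, true_and, Finset.mem_union]; omega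
  · rw [Finset.disjoint_filter]; intro i _ h; omega

/-- Past the last level the cut profile is everything. [folklore] -/
theorem cut_eq_card {m : ℕ} (lvl : Fin m → ℕ) {L : ℕ} (hlvl : ∀ i, lvl i < L) (t : ℕ) (ht : L ≤ t) :
    (Finset.univ.filter (fun i => lvl i < t)).card = m := by
  classical
  rw [Finset.filter_true_of_mem fun i _ => (hlvl i).trans_le ht, Finset.card_univ, Fintype.card_fin]

/-- A re-indexing of a level by `Fin s` from a card computation. [folklore] -/
theorem exists_level_equiv {m : ℕ} (lvl : Fin m → ℕ) (t s : ℕ)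
    (h : (Finset.univ.filter (fun i => lvl i = t)).card = s) : Nonempty ({i : Fin m // lvl i = t} ≃ Fin s) := by
  classical
  refine ⟨Fintype.equivFinOfCardEq ?_⟩
  rw [Fintype.card_subtype, h]

/-! ## §2 `HeavyTopInst 4 6` from `ι(4) ≤ 3`, `ι(5) ≤ 7`, `ι(6) ≤ 11` -/

set_option maxHeartbeats 1600000 in
/-- **`ι(4) ≤ 3 ∧ ι(5) ≤ 7 ∧ ι(6) ≤ 11 ⟹ HeavyTopInst 4 6`** (INSTANCES.md v2.2a §7, kernel form; the `ι`-bounds are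
HYPOTHESES on irreducible nilpotent subspaces of `M_4(ℂ)`, `M_5(ℂ)`, `M_6(ℂ)`).  Conditional instance row; NOT a proof of
`HeavyTopInst 4 6`, `HeavyTopLaw` or 24318. [folklore bookkeeping over Theorem G] -/
theorem heavyTopInst_four_six_of_iota
    (hι4 : ∀ V : Submodule ℂ (Matrix (Fin 4) (Fin 4) ℂ), (∀ A ∈ V, IsNilpotent A) →
      (∀ U : Submodule ℂ (Fin 4 → ℂ), (∀ A ∈ V, ∀ x ∈ U, A *ᵥ x ∈ U) → U = ⊥ ∨ U = ⊤) →
      Module.finrank ℂ V ≤ 3)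
    (hι5 : ∀ V : Submodule ℂ (Matrix (Fin 5) (Fin 5) ℂ), (∀ A ∈ V, IsNilpotent A) →
      (∀ U : Submodule ℂ (Fin 5 → ℂ), (∀ A ∈ V, ∀ x ∈ U, A *ᵥ x ∈ U) → U = ⊥ ∨ U = ⊤) →
      Module.finrank ℂ V ≤ 7)
    (hι6 : ∀ V : Submodule ℂ (Matrix (Fin 6) (Fin 6) ℂ), (∀ A ∈ V, IsNilpotent A) →
      (∀ U : Submodule ℂ (Fin 6 → ℂ), (∀ A ∈ V, ∀ x ∈ U, A *ᵥ x ∈ U) → U = ⊥ ∨ U = ⊤) →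
      Module.finrank ℂ V ≤ 11) :
    HeavyTopInst 4 6 := by
  classical
  intro N hN hnil _
  -- the nilpotent space `W = ℂ·N(0) + N_lin` and its composition chain in matrix clothes
  obtain ⟨T, hT⟩ := exists_topMap_linPart N hN
  obtain ⟨P, L, lvl, hlvl, _hLm, hne, hblk, hirr⟩ :=
    exists_block_conj (((ℂ ∙ N.map (MvPolynomial.eval 0)) ⊔ LinearMap.range T : Submodule ℂ (Matrix (Fin 6) (Fin 6) ℂ)) :
      Set (Matrix (Fin 6) (Fin 6) ℂ))
  have hPW : ∀ A ∈ (ℂ ∙ N.map (MvPolynomial.eval 0)) ⊔ LinearMap.range T, ∀ i j : Fin 6, lvl i < lvl j →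
      ((P : Matrix (Fin 6) (Fin 6) ℂ) * A * (↑P⁻¹ : Matrix (Fin 6) (Fin 6) ℂ)) i j = 0 := fun A hA => hblk A hA
  have hpoly := pencil_blockUpper_of_forall_mem N T hT P lvl hPW
  -- Gerstenhaber and the irreducible bounds, per block
  have hGer : ∀ (s : ℕ) (V : Submodule ℂ (Matrix (Fin s) (Fin s) ℂ)), (∀ B ∈ V, IsNilpotent B) →
      (∀ U : Submodule ℂ (Fin s → ℂ), (∀ B ∈ V, ∀ x ∈ U, B *ᵥ x ∈ U) → U = ⊥ ∨ U = ⊤) →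
      Module.finrank ℂ V ≤ s.choose 2 := fun s V hV _ => finrank_le_choose_two s V hV
  have hbound : ∀ (t : ℕ), t < L → ∀ (s : ℕ) (e : {i : Fin 6 // lvl i = t} ≃ Fin s) (β : ℕ),
      (∀ V : Submodule ℂ (Matrix (Fin s) (Fin s) ℂ), (∀ B ∈ V, IsNilpotent B) →
        (∀ U : Submodule ℂ (Fin s → ℂ), (∀ B ∈ V, ∀ x ∈ U, B *ᵥ x ∈ U) → U = ⊥ ∨ U = ⊤) →
        Module.finrank ℂ V ≤ β) →
      Module.finrank ℂ (Submodule.span ℂ (Set.range fun v : Fin 4 × Fin 4 → ℂ =>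
        Matrix.reindex e e (((P : Matrix (Fin 6) (Fin 6) ℂ) * linPart N v * (↑P⁻¹ : Matrix (Fin 6) (Fin 6) ℂ)).toBlock
          (fun i => lvl i = t) (fun i => lvl i = t)))) ≤ β :=
    fun t ht s e β hβ => finrank_blockSpan_le N hN hnil T hT P lvl hPW t e β hβ (hirr t ht s e)
  -- the cut profile
  have hcut0 : (Finset.univ.filter (fun i : Fin 6 => lvl i < 0)).card = 0 := by simp
  have hcutL : ∀ t, L ≤ t → (Finset.univ.filter (fun i : Fin 6 => lvl i < t)).card = 6 := cut_eq_card lvl hlvl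
  have hstep : ∀ t, t < L → (Finset.univ.filter (fun i : Fin 6 => lvl i < t)).card <
      (Finset.univ.filter (fun i : Fin 6 => lvl i < t + 1)).card := by
    intro t ht; rw [cut_succ]; have := hne t ht; omega
  have hL1 : 1 ≤ L := Nat.succ_le_of_lt (Nat.lt_of_le_of_lt (Nat.zero_le _) (hlvl 0))
  by_cases hA : ∃ t, 2 ≤ (Finset.univ.filter (fun i : Fin 6 => lvl i < t)).card ∧
      (Finset.univ.filter (fun i : Fin 6 => lvl i < t)).card ≤ 4
  · -- COARSEN at the cut `t`: two levels, Gerstenhaber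
    obtain ⟨t, h2, h4⟩ := hA
    let lvl' : Fin 6 → ℕ := fun i => if lvl i < t then 0 else 1
    have hlvl' : ∀ i, lvl' i < 2 := fun i => by dsimp only [lvl']; split_ifs <;> norm_num
    have hblock' : ∀ i j : Fin 6, lvl' i < lvl' j →
        ((P : Matrix (Fin 6) (Fin 6) ℂ).map C * N * (↑P⁻¹ : Matrix (Fin 6) (Fin 6) ℂ).map C :
          Matrix (Fin 6) (Fin 6) (MvPolynomial (Fin 4 × Fin 4) ℂ)) i j = 0 := by
      intro i j hij
      apply hpoly i j
      dsimp only [lvl'] at hij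
      split_ifs at hij with hi hj <;> omega
    have hc0 : Fintype.card {i : Fin 6 // lvl' i = 0} = (Finset.univ.filter (fun i : Fin 6 => lvl i < t)).card := by
      rw [Fintype.card_subtype]; congr 1; ext i; simp [lvl']
    have hc1 : Fintype.card {i : Fin 6 // lvl' i = 1} = 6 - (Finset.univ.filter (fun i : Fin 6 => lvl i < t)).card := by
      rw [Fintype.card_subtype]
      have h := Finset.card_filter_add_card_filter_not (s := (Finset.univ : Finset (Fin 6))) (fun i => lvl i < t)
      rw [Finset.card_univ, Fintype.card_fin] at h
      have h' : (Finset.univ.filter (fun i : Fin 6 => lvl' i = 1)) = Finset.univ.filter (fun i => ¬ lvl i < t) := by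
        ext i; simp [lvl']
      rw [h']; omega
    refine flagCheap_of_invariant_levels N hN hnil P lvl' 2 (by norm_num) hlvl' hblock' ?_
    rw [Finset.sum_range_succ, Finset.sum_range_succ, Finset.sum_range_zero, zero_add, hc0, hc1]
    set x := (Finset.univ.filter (fun i : Fin 6 => lvl i < t)).card with hx
    interval_cases x <;> decide
  · -- every cut is `≤ 1` or `≥ 5`: the composition is `(6)`, `(1,5)`, `(5,1)` or `(1,4,1)`
    obtain ⟨a, ha⟩ : ∃ a : ℕ → ℕ, ∀ t, a t = (Finset.univ.filter (fun i : Fin 6 => lvl i < t)).card :=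
      ⟨_, fun _ => rfl⟩
    have ha0 : a 0 = 0 := by rw [ha]; simp
    have haL : ∀ t, L ≤ t → a t = 6 := fun t ht => by rw [ha]; exact hcutL t ht
    have hst : ∀ t, t < L → a t < a (t + 1) := fun t ht => by rw [ha, ha]; exact hstep t ht
    have hsize : ∀ t, (Finset.univ.filter (fun i : Fin 6 => lvl i = t)).card = a (t + 1) - a t := by
      intro t; rw [ha, ha, cut_succ]; omega
    have hB : ∀ t, a t ≤ 1 ∨ 5 ≤ a t := by
      intro t
      by_contra h
      push Not at h
      exact hA ⟨t, by rw [← ha]; omega, by rw [← ha]; omega⟩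
    have h1 : a 0 < a 1 := hst 0 (by omega)
    have hB1 := hB 1
    have hB2 := hB 2
    have hB3 := hB 3
    -- how many levels?
    rcases Nat.lt_or_ge L 4 with hL4 | hL4
    swap
    · -- `L ≥ 4` is impossible
      exfalso
      have h2 : a 1 < a 2 := hst 1 (by omega)
      have h3 : a 2 < a 3 := hst 2 (by omega)
      have h4 : a 3 < a 4 := hst 3 (by omega)
      have h6 : a 4 ≤ 6 := by
        rw [ha]
        calc _ ≤ (Finset.univ : Finset (Fin 6)).card := Finset.card_filter_le _ _
          _ = 6 := by simp
      omega
    interval_cases L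
    · -- one level: the whole space is IRREDUCIBLE for `W`, size 6
      have hs0 : (Finset.univ.filter (fun i : Fin 6 => lvl i = 0)).card = 6 := by
        rw [hsize, haL 1 le_rfl, ha0]
      obtain ⟨e0⟩ := exists_level_equiv lvl 0 6 hs0
      refine flagCheap_of_block_dims N hN P lvl 1 le_rfl hlvl hpoly (fun _ => 11) (fun t => ?_) (by decide)
      fin_cases t
      exact ⟨6, e0, hbound 0 (by omega) 6 e0 11 hι6⟩
    · -- two levels: `(1,5)` or `(5,1)`
      have hc2 : a 2 = 6 := haL 2 le_rfl
      have h2 : a 1 < a 2 := hst 1 (by omega)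
      have hs0 : (Finset.univ.filter (fun i : Fin 6 => lvl i = 0)).card = a 1 - a 0 := hsize 0
      have hs1 : (Finset.univ.filter (fun i : Fin 6 => lvl i = 1)).card = a 2 - a 1 := hsize 1
      rcases hB1 with hlo | hhi
      · -- `(1,5)`
        rw [ha0] at hs0
        have hs0' : (Finset.univ.filter (fun i : Fin 6 => lvl i = 0)).card = 1 := by rw [hs0]; omega
        have hs1' : (Finset.univ.filter (fun i : Fin 6 => lvl i = 1)).card = 5 := by rw [hs1]; omega
        obtain ⟨e0⟩ := exists_level_equiv lvl 0 1 hs0'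
        obtain ⟨e1⟩ := exists_level_equiv lvl 1 5 hs1'
        refine flagCheap_of_block_dims N hN P lvl 2 (by norm_num) hlvl hpoly (fun t => if t = 0 then 0 else 7)
          (fun t => ?_) (by decide)
        fin_cases t
        · exact ⟨1, e0, (hbound 0 (by omega) 1 e0 (Nat.choose 1 2) (hGer 1)).trans (by decide)⟩
        · exact ⟨5, e1, hbound 1 (by omega) 5 e1 7 hι5⟩
      · -- `(5,1)`
        rw [ha0] at hs0
        have hs0' : (Finset.univ.filter (fun i : Fin 6 => lvl i = 0)).card = 5 := by rw [hs0]; omega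
        have hs1' : (Finset.univ.filter (fun i : Fin 6 => lvl i = 1)).card = 1 := by rw [hs1]; omega
        obtain ⟨e0⟩ := exists_level_equiv lvl 0 5 hs0'
        obtain ⟨e1⟩ := exists_level_equiv lvl 1 1 hs1'
        refine flagCheap_of_block_dims N hN P lvl 2 (by norm_num) hlvl hpoly (fun t => if t = 0 then 7 else 0)
          (fun t => ?_) (by decide)
        fin_cases t
        · exact ⟨5, e0, hbound 0 (by omega) 5 e0 7 hι5⟩
        · exact ⟨1, e1, (hbound 1 (by omega) 1 e1 (Nat.choose 1 2) (hGer 1)).trans (by decide)⟩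
    · -- three levels: `(1,4,1)`
      have h2 : a 1 < a 2 := hst 1 (by omega)
      have h3 : a 2 < a 3 := hst 2 (by omega)
      have hc3 : a 3 = 6 := haL 3 le_rfl
      have hs0 : (Finset.univ.filter (fun i : Fin 6 => lvl i = 0)).card = 1 := by
        have h : (Finset.univ.filter (fun i : Fin 6 => lvl i = 0)).card = a 1 - a 0 := hsize 0
        rw [h, ha0]; omega
      have hs1 : (Finset.univ.filter (fun i : Fin 6 => lvl i = 1)).card = 4 := by
        have h : (Finset.univ.filter (fun i : Fin 6 => lvl i = 1)).card = a 2 - a 1 := hsize 1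
        rw [h]; omega
      have hs2 : (Finset.univ.filter (fun i : Fin 6 => lvl i = 2)).card = 1 := by
        have h : (Finset.univ.filter (fun i : Fin 6 => lvl i = 2)).card = a 3 - a 2 := hsize 2
        rw [h]; omega
      obtain ⟨e0⟩ := exists_level_equiv lvl 0 1 hs0
      obtain ⟨e1⟩ := exists_level_equiv lvl 1 4 hs1
      obtain ⟨e2⟩ := exists_level_equiv lvl 2 1 hs2
      refine flagCheap_of_block_dims N hN P lvl 3 (by norm_num) hlvl hpoly (fun t => if t = 1 then 3 else 0)
        (fun t => ?_) (by decide)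
      fin_cases t
      · exact ⟨1, e0, (hbound 0 (by omega) 1 e0 (Nat.choose 1 2) (hGer 1)).trans (by decide)⟩
      · exact ⟨4, e1, hbound 1 (by omega) 4 e1 3 hι4⟩
      · exact ⟨1, e2, (hbound 2 (by omega) 1 e2 (Nat.choose 1 2) (hGer 1)).trans (by decide)⟩

end Summit.ValiantsHypothesis.ValiantsHypothesis.Theorems.GrenetZeon.HeavyTopCompositionBound

end
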